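import Summits.ABC.IUTFork.LanaRealHullChecks
import HarnessLib

/-!
# L-LANA checks II: over the REAL container, the inequality (8-1) HOLDS for some inputs and FAILS for others — it is a property of the possible images, not of the container / hull / Kummer machinery

Record-only check file (D-0012) of the abc-iut cell (seat abc-iut-c312-4, L-LANA level; companion of
`LanaRealHullChecks.lean`, in the spirit of LANA Rem. 8.2.1 and of the cell's Team-R question "under which
identification does the inequality become vacuous/false"); TAKES NO SIDE on [IUTchIII] Cor. 3.12 — the inputs
below are synthetic, NOT the output of Thm. 3.11's algorithm. Over the real container `ℚ_p` with `O_L = ℤ_p` and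
the REAL hull (S2 `holomorphicHull`), keep the `q`-pilot element `q := p` (so the `q`-region is `p·ℤ_p`) and
vary only the possible images `⋃_λ U_λ`:
* `LanaRealHullChecks.padicInput` (`⋃_λ U_λ := p·ℤ_p`): (9-1) holds and **(8-1) holds** (there, and
  `padicInput_cor312'` here);
* `padicInputSq` (`⋃_λ U_λ := p²·ℤ_p`, one suitable `S := p²·ℤ_p`): the hull is `p²·ℤ_p ⊊ p·ℤ_p`, the difference
  contains the open nonempty set `{‖x‖ = ‖p‖}`, so `μ(hull) < μ(q·O)` and **(8-1) FAILS**
  (`padicInputSq_not_cor312`); consequently (9-1) fails for it too (`padicInputSq_not_mainGoal`, contrapositive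
  of gen-0 `cor312_of_mainGoal`).
So with the container, the normalised Haar measure, the hull, the log-shells and the Kummer maps all REAL,
"`−|log(q)| ≤ −|log(Θ)|`" is decided by WHICH regions the Θ-pilot object can occupy — the content of
[IUTchIII] Thm. 3.11 / (Ind1–3), typed elsewhere in the cell and not asserted. [cite: LANA2026Report,
§8.1 (8-1) p. 41, Rem. 8.2.1 p. 42, §10.4 p. 49] NOT here: any judgement.
-/

noncomputable section

open MeasureTheory Set Metric Bornology
open Literature.IUT.LogVolume

namespace Summit.ABC
namespace IUTFork

namespace RealHullChecks

variable (p : ℕ) [hp : Fact p.Prime] [MeasurableSpace ℚ_[p]] [BorelSpace ℚ_[p]]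

/-- (8-1) for the first witness, restated: `log μ(p·ℤ_p) ≤ log μ(hull(p·ℤ_p))`. [cite: LANA2026Report, §8.1 (8-1) p. 41] -/
theorem padicInput_cor312' : (padicInput p).etaData.negAbsLogq ≤ (padicInput p).etaData.negAbsLogTheta :=
  (padicInput p).etaData.cor312_of_mainGoal (padicInput p).suitableInHull (padicInput_mainGoal p)

/-- The element `p²` in the (single) summand. [folklore] -/
def sqElt : Π _ : Unit, ℚ_[p] := fun _ => (p : ℚ_[p]) ^ 2

omit [MeasurableSpace ℚ_[p]] [BorelSpace ℚ_[p]] in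
/-- `p² ≠ 0` in `ℚ_p`. [folklore] -/
theorem sqElt_ne (j : Unit) : sqElt p j ≠ 0 := pow_ne_zero 2 (qElt_ne p j)

/-- The region `p²·ℤ_p`. [folklore] -/
def sqRegion : Region (intStructure p).haar := hullSetRegion (summand p) (intStructure p) (sqElt p) (sqElt_ne p)

/-- **Second input**: same container, same `q := p`, possible images `p²·ℤ_p`, one suitable `S := p²·ℤ_p`.
[cite: LANA2026Report, §9.2 p. 46] -/
def padicInputSq : RealHullInput (summand p) (intStructure p) where
  Rval := volLine 1 one_ne_zero
  q := qElt p
  q_ne := qElt_ne p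
  LGP S := S
  Suitable := {sqRegion p}
  images := hullSet (summand p) (sqElt p)
  images_bounded := isBounded_hullSet (summand p) (sqElt p)
  images_nondegenerate := IsHullSet.isNondegenerate (summand p) ⟨sqElt p, sqElt_ne p, rfl⟩
  lgp_subset S hS := by
    rw [Set.mem_singleton_iff] at hS
    subst hS
    exact subset_rfl

omit [MeasurableSpace ℚ_[p]] [BorelSpace ℚ_[p]] in
/-- `p²·ℤ_p ⊆ p·ℤ_p`. [folklore] -/
theorem sqSet_subset : hullSet (summand p) (sqElt p) ⊆ hullSet (summand p) (qElt p) := by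
  intro x hx
  rw [hullSet, mem_polydisc] at hx ⊢
  intro j
  refine (hx j).trans ?_
  change ‖(p : ℚ_[p]) ^ 2‖ ≤ ‖(p : ℚ_[p])‖
  rw [norm_pow, sq]
  exact mul_le_of_le_one_left (norm_nonneg _) (Padic.norm_p_lt_one (p := p)).le

omit [MeasurableSpace ℚ_[p]] [BorelSpace ℚ_[p]] in
/-- The "sphere" `{x | ‖x‖ = ‖p‖}` lies in `p·ℤ_p ∖ p²·ℤ_p`. [folklore] -/
theorem sphere_subset_diff :
    {x : Π _ : Unit, ℚ_[p] | ‖x ()‖ = ‖(p : ℚ_[p])‖} ⊆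
      hullSet (summand p) (qElt p) \ hullSet (summand p) (sqElt p) := by
  intro x hx
  rw [Set.mem_setOf_eq] at hx
  constructor
  · rw [hullSet, mem_polydisc]
    intro j
    change ‖x j‖ ≤ ‖(p : ℚ_[p])‖
    rw [show j = () from rfl, hx]
  · intro hmem
    rw [hullSet, mem_polydisc] at hmem
    have h := hmem ()
    change ‖x ()‖ ≤ ‖(p : ℚ_[p]) ^ 2‖ at h
    rw [hx, norm_pow, sq] at h
    have hp0 : 0 < ‖(p : ℚ_[p])‖ := norm_pos_iff.mpr (qElt_ne p ())
    have : ‖(p : ℚ_[p])‖ * ‖(p : ℚ_[p])‖ < ‖(p : ℚ_[p])‖ * 1 := by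
      rw [mul_one]; exact mul_lt_of_lt_one_right hp0 (Padic.norm_p_lt_one (p := p))
    exact absurd h (not_le.mpr (by rw [mul_one] at this; exact this))

omit [MeasurableSpace ℚ_[p]] [BorelSpace ℚ_[p]] in
/-- That set is OPEN (spheres are open in ultrametric spaces) and nonempty. [folklore] -/
theorem isOpen_sphereSet :
    IsOpen {x : Π _ : Unit, ℚ_[p] | ‖x ()‖ = ‖(p : ℚ_[p])‖} ∧
      (fun _ => (p : ℚ_[p])) ∈ {x : Π _ : Unit, ℚ_[p] | ‖x ()‖ = ‖(p : ℚ_[p])‖} := by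
  refine ⟨?_, rfl⟩
  have h : {x : Π _ : Unit, ℚ_[p] | ‖x ()‖ = ‖(p : ℚ_[p])‖} =
      (fun x : Π _ : Unit, ℚ_[p] => x ()) ⁻¹' sphere (0 : ℚ_[p]) ‖(p : ℚ_[p])‖ := by
    ext x; simp
  rw [h]
  exact (IsUltrametricDist.isOpen_sphere (0 : ℚ_[p]) (norm_pos_iff.mpr (qElt_ne p ())).ne').preimage
    (continuous_apply ())

/-- **`μ(p²·ℤ_p) < μ(p·ℤ_p)`** for the normalised Haar measure of the real container: the difference contains a
nonempty open set. [cite: LANA2026Report, §5.2 (e) p. 29] -/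
theorem haar_sq_lt :
    (intStructure p).haar (hullSet (summand p) (sqElt p)) < (intStructure p).haar (hullSet (summand p) (qElt p)) := by
  have hpos : 0 < (intStructure p).haar (hullSet (summand p) (qElt p) \ hullSet (summand p) (sqElt p)) :=
    ((intStructure p).haar_pos_of_isOpen (isOpen_sphereSet p).1 ⟨_, (isOpen_sphereSet p).2⟩).trans_le
      (measure_mono (sphere_subset_diff p))
  have hunion : hullSet (summand p) (sqElt p) ∪ (hullSet (summand p) (qElt p) \ hullSet (summand p) (sqElt p)) =
      hullSet (summand p) (qElt p) := Set.union_sdiff_cancel (sqSet_subset p)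
  have hdisj : Disjoint (hullSet (summand p) (sqElt p))
      (hullSet (summand p) (qElt p) \ hullSet (summand p) (sqElt p)) := Set.disjoint_sdiff_right
  have hmeas : MeasurableSet (hullSet (summand p) (qElt p) \ hullSet (summand p) (sqElt p)) :=
    (pRegion p).measurable.diff (sqRegion p).measurable
  calc (intStructure p).haar (hullSet (summand p) (sqElt p))
      < (intStructure p).haar (hullSet (summand p) (sqElt p)) +
          (intStructure p).haar (hullSet (summand p) (qElt p) \ hullSet (summand p) (sqElt p)) :=
        ENNReal.lt_add_right (sqRegion p).vol_ne_top hpos.ne'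
    _ = (intStructure p).haar (hullSet (summand p) (qElt p)) := by rw [← measure_union hdisj hmeas, hunion]

/-- **(8-1) FAILS for the second input**: `−|log(q)| = log μ(p·ℤ_p) > log μ(p²·ℤ_p) = −|log(Θ)|` (the hull of
`p²·ℤ_p` is itself). [cite: LANA2026Report, §8.1 (8-1) p. 41, Rem. 8.2.1 p. 42] -/
theorem padicInputSq_not_cor312 :
    ¬ ((padicInputSq p).etaData.negAbsLogq ≤ (padicInputSq p).etaData.negAbsLogTheta) := by
  rw [(padicInputSq p).negAbsLogq_eq, (padicInputSq p).negAbsLogTheta_eq, not_le]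
  change (intStructure p).logVolume (holomorphicHull (summand p) (hullSet (summand p) (sqElt p))) <
    (intStructure p).logVolume (hullSet (summand p) (qElt p))
  rw [holomorphicHull_hullSet]
  unfold IntegralStructure.logVolume
  exact Real.log_lt_log (sqRegion p).toReal_vol_pos
    (ENNReal.toReal_strict_mono (pRegion p).vol_ne_top (haar_sq_lt p))

/-- … hence (9-1) FAILS for the second input as well (gen-0 `cor312_of_mainGoal`, contrapositive), although its
`Suitable` is nonempty. [cite: LANA2026Report, §9.2 (9-1) p. 46] -/
theorem padicInputSq_not_mainGoal : ¬ (padicInputSq p).etaData.MainGoal := fun h =>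
  padicInputSq_not_cor312 p ((padicInputSq p).etaData.cor312_of_mainGoal (padicInputSq p).suitableInHull h)

/-- The two inputs share the container, the measure, the `q`-region and the hull CONSTRUCTION; they differ
only in the possible images. [cite: LANA2026Report, §10.4 p. 49] -/
theorem inputs_differ_only_in_images :
    (padicInput p).etaData.qRegion.carrier = (padicInputSq p).etaData.qRegion.carrier ∧
      (padicInput p).images ≠ (padicInputSq p).images := by
  refine ⟨rfl, fun h => ?_⟩
  have hmem : (fun _ => (p : ℚ_[p])) ∈ (padicInput p).images :=
    (mem_polydisc (summand p)).mpr fun _ => le_rfl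
  rw [h] at hmem
  exact ((sphere_subset_diff p) (show ‖(p : ℚ_[p])‖ = ‖(p : ℚ_[p])‖ from rfl)).2 hmem

end RealHullChecks

end IUTFork

end Summit.ABC

end
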